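import Summits.CriticalPhenomena.CardyFormulaZ2.Theses.CardyQContinuation
import Summits.CriticalPhenomena.CardyFormulaZ2.Theorems.CardyQContinuationIsingJetsConformalStubDesignLowerContinuumPart2

/-!
# Crux `IsingJetsConformal`, stub `stub_design_upper_continuum`, part 2:
# reading perturbations of the short wide model rectangle in the model square
# (route `CardyQContinuation`, item stmt-CriticalPhenomena-5560, `n = 0` bridge)

Let `Ψ : ℂ ≃ₜ ℂ` map the model square `(-1, 1)²` onto a conformal rectangle `R`, its bottom side
onto `R.arc 0` and its top side onto `R.arc 2`, and for `0 < t ≤ 1/4` let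
`D_t = Ψ((-1-t, 1+t) × (-1+t, 1-t))` (`perturbQuad`) be the image of the WIDER and SHORTER
rectangle: it sticks out of `R` across the arcs `1`, `3` and is cut inside along the arcs `0`, `2`.

* `DesignUpperContinuum.upper_model_reading` — there is `ε₁ > 0` (depending on `Ψ`, `t`) such
  that every conformal rectangle `P` with the quarter marks whose boundary loop is uniformly
  `ε₁`-close to `∂D_t` satisfies: its free arcs `1`, `3` lie outside `closure R`; its closure
  misses `R.arc 0 ∪ R.arc 2`; every point of `closure R ∖ P` is, read in the model through
  `Ψ⁻¹`, within `3t` of the bottom or top side of the square; every point of `P.arc 0`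
  (`P.arc 2`) is, read in the model, within `3t` of the bottom (top) side. This is the "reading
  in the model" of the tree's `exists_upper_sandwich` (dog-on-leash for closures and interiors,
  uniform continuity of `Ψ⁻¹` near the closed rectangle, arcs with equal marks are close).
* `DesignUpperContinuum.exists_forall_dist_perturbQuad_boundary_lt` — `∂D_t → ∂(Ψ(square))`
  uniformly as `t → 0⁺` (both loops are `Ψ ∘` closed polygons through four corners, the corners
  are `2t`-close — `DesignLowerContinuum.dist_rectVerts_getElem_le` of the mirror stub —, `Ψ` is
  uniformly continuous on a compact square).
* `DesignUpperContinuum.exists_arcs_separated` — no point is `2s`-close to both `R.arc 0` and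
  `R.arc 2` for `s` a fifth of their distance.

No new definitions; no new mathematics. [folklore]
-/

noncomputable section

namespace Summit.CriticalPhenomena.CardyFormulaZ2.Theorems.CardyQContinuation

open Set Metric Filter Topology Complex
open Literature.Probability.RandomPlanarGeometry Literature.Probability.Percolation

namespace DesignUpperContinuum

/-- The distance to a point given in coordinates is at most the sum of the coordinate
differences. [folklore] -/
theorem dist_mk_le (w : ℂ) (x y : ℝ) : dist w ⟨x, y⟩ ≤ |w.re - x| + |w.im - y| := by
  rw [Complex.dist_eq]
  exact (Complex.norm_le_abs_re_add_abs_im _).trans (le_of_eq (by simp))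

/-- Clamping a real number of `[-1-t, 1+t]` to `[-1, 1]` moves it by at most `t`. [folklore] -/
theorem abs_sub_clamp_le {x t : ℝ} (ht : 0 ≤ t) (hx : x ∈ Icc (-1 - t) (1 + t)) :
    |x - max (-1) (min 1 x)| ≤ t := by
  obtain ⟨h1, h2⟩ := hx
  rcases le_total x (-1) with h | h
  · rw [min_eq_right (by linarith), max_eq_left h, abs_le]; constructor <;> linarith
  · rcases le_total x 1 with h' | h'
    · rw [min_eq_right h', max_eq_right h, sub_self, abs_zero]; exact ht
    · rw [min_eq_left h', max_eq_right (by linarith), abs_le]; constructor <;> linarith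

/-- The clamp lands in `[-1, 1]`. [folklore] -/
theorem clamp_mem_Icc (x : ℝ) : max (-1) (min 1 x) ∈ Icc (-1 : ℝ) 1 :=
  ⟨le_max_left _ _, max_le (by norm_num) (min_le_left _ _)⟩

/-- **Reading perturbations of the short wide model rectangle in the model.** See the module
docstring. [folklore] -/
theorem upper_model_reading (R : ConformalRectangle) (Ψ : ℂ ≃ₜ ℂ)
    (hcar : Ψ '' unitSquareQuad.carrier = R.carrier) (h0 : Ψ '' unitSquareQuad.arc 0 = R.arc 0)
    (h2 : Ψ '' unitSquareQuad.arc 2 = R.arc 2) {t : ℝ} (ht : 0 < t) (ht4 : t ≤ 1 / 4) :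
    ∃ ε₁ > 0, ∀ P : ConformalRectangle, (∀ i, P.mark i = quarterMarks i) →
      (∀ s, dist (P.boundary s)
        ((perturbQuad Ψ (-1 - t) (1 + t) (-1 + t) (1 - t) (by linarith) (by linarith)).boundary s)
          ≤ ε₁) →
      P.arc 1 ∪ P.arc 3 ⊆ (closure R.carrier)ᶜ ∧
      closure P.carrier ∩ (R.arc 0 ∪ R.arc 2) = ∅ ∧
      (∀ z ∈ closure R.carrier \ P.carrier,
        ∃ w ∈ unitSquareQuad.arc 0 ∪ unitSquareQuad.arc 2, dist (Ψ.symm z) w ≤ 3 * t) ∧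
      (∀ z ∈ P.arc 0, ∃ w ∈ unitSquareQuad.arc 0, dist (Ψ.symm z) w ≤ 3 * t) ∧
      (∀ z ∈ P.arc 2, ∃ w ∈ unitSquareQuad.arc 2, dist (Ψ.symm z) w ≤ 3 * t) := by
  have hx : (-1 - t : ℝ) < 1 + t := by linarith
  have hy : (-1 + t : ℝ) < 1 - t := by linarith
  set D := perturbQuad Ψ (-1 - t) (1 + t) (-1 + t) (1 - t) hx hy with hD
  -- the closure of `R` in the model
  have hclR : closure R.carrier = Ψ '' (Icc (-1) 1 ×ℂ Icc (-1) 1) := by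
    rw [← hcar, ← Ψ.image_closure, unitSquareQuad_carrier, Complex.closure_reProdIm,
      closure_Ioo (by norm_num)]
  -- the model tolerance and the uniform continuity of `Ψ⁻¹` near the closed rectangle
  set ε₂ : ℝ := t / 4 with hε₂
  have hε₂pos : 0 < ε₂ := by positivity
  have hε₂t : ε₂ < t := by rw [hε₂]; linarith
  set K : Set ℂ := Icc (-1 - t) (1 + t) ×ℂ Icc (-1 + t) (1 - t) with hK
  have hKc : IsCompact K := isCompact_Icc.reProdIm isCompact_Icc
  obtain ⟨ε₁', hε₁', -, hΨ⟩ := exists_forall_dist_symm_le Ψ hKc hε₂pos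
  -- the middle band of the closed square is a compact subset of `D`, off `∂D`
  set Kmid : Set ℂ := Ψ '' (Icc (-1) 1 ×ℂ Icc (-1 + 2 * t) (1 - 2 * t)) with hKmid
  have hKmidc : IsCompact Kmid := (isCompact_Icc.reProdIm isCompact_Icc).image Ψ.continuous
  have hKmidD : Kmid ⊆ D.carrier := by
    rintro _ ⟨w, hw, rfl⟩
    rw [hD, perturbQuad, MarkedDomain.carrier_map, Ψ.injective.mem_set_image,
      mem_rectQuad_carrier]
    obtain ⟨⟨h1, h2⟩, h3, h4⟩ := mem_reProdIm.1 hw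
    exact ⟨⟨by linarith, by linarith⟩, by linarith, by linarith⟩
  have hfrne : (frontier D.carrier).Nonempty := ⟨_, D.boundary_mem_frontier 0⟩
  have hfrc : IsCompact (frontier D.carrier) := D.isCompact_frontier
  obtain ⟨d₀, hd₀, hfar⟩ := exists_pos_forall_lt_dist hKmidc isClosed_frontier
    (Set.disjoint_left.2 fun z hz hz' =>
      Set.disjoint_left.1 D.disjoint_carrier_frontier (hKmidD hz) hz')
  refine ⟨min ε₁' (d₀ / 2), by positivity, fun P hmark hclose => ?_⟩
  have hclose' : ∀ s, dist (P.boundary s) (D.boundary s) ≤ ε₁' :=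
    fun s => (hclose s).trans (min_le_left _ _)
  have hmarkD : ∀ i, P.mark i = D.mark i := fun i => by rw [hmark, hD, perturbQuad_mark]
  -- reading a point of `closure P` in the model: its height is that of `K`, up to `ε₂`
  have hmodel : ∀ z ∈ closure P.carrier, (Ψ.symm z).im ∈ Icc (-1 + t - ε₂) (1 - t + ε₂) := by
    intro z hz
    rcases mem_closure_or_infDist_le D.toJordanDomain P.toJordanDomain hclose' hz with h | h
    · rw [hD, mem_closure_perturbQuad_carrier] at h
      obtain ⟨-, h3, h4⟩ := h
      exact ⟨by linarith, by linarith⟩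
    · obtain ⟨q, hq, hqd⟩ := hfrc.exists_infDist_eq_dist hfrne z
      obtain ⟨q', hq', rfl⟩ := frontier_perturbQuad_subset Ψ _ _ hq
      have hd : dist (Ψ.symm z) q' ≤ ε₂ := hΨ q' hq' z (hqd ▸ h)
      have him := abs_le.1 (abs_im_sub_le_of_dist_le hd)
      obtain ⟨-, h3, h4⟩ := mem_reProdIm.1 hq'
      exact ⟨by linarith, by linarith⟩
  -- reading the arcs of `P` in the model
  have harc : ∀ (i : Fin 4), ∀ z ∈ P.arc i,
      ∃ q' ∈ (rectQuad (-1 - t) (1 + t) (-1 + t) (1 - t) hx hy).arc i,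
        dist (Ψ.symm z) q' ≤ ε₂ := by
    intro i z hz
    obtain ⟨s, rfl, hs⟩ := exists_param_of_mem_arc hmarkD hz
    rw [hD, perturbQuad, MarkedDomain.arc_map, mem_image_homeomorph_iff] at hs
    refine ⟨_, hs, hΨ _ ?_ _ (by rw [Homeomorph.apply_symm_apply]; exact hclose' s)⟩
    have := frontier_subset_closure
      ((rectQuad (-1 - t) (1 + t) (-1 + t) (1 - t) hx hy).arc_subset_frontier i hs)
    rwa [closure_rectQuad_carrier] at this
  refine ⟨?_, ?_, ?_, ?_, ?_⟩
  · -- the free arcs `1`, `3` of `P` lie outside `closure R`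
    rintro z hz hzR
    rw [hclR, mem_image_homeomorph_iff, mem_reProdIm] at hzR
    obtain ⟨⟨hre1, hre2⟩, -⟩ := hzR
    rcases hz with hz | hz
    · obtain ⟨q', hq', hd⟩ := harc 1 z hz
      rw [mem_rectQuad_arc_one] at hq'
      have hre := abs_le.1 (abs_re_sub_le_of_dist_le hd)
      rw [hq'.1] at hre; linarith
    · obtain ⟨q', hq', hd⟩ := harc 3 z hz
      rw [mem_rectQuad_arc_three] at hq'
      have hre := abs_le.1 (abs_re_sub_le_of_dist_le hd)
      rw [hq'.1] at hre; linarith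
  · -- `closure P` misses the arcs `0`, `2` of `R`
    refine Set.eq_empty_iff_forall_notMem.2 fun z hz => ?_
    obtain ⟨hzP, hzR⟩ := hz
    have him := hmodel z hzP
    rw [← h0, ← h2] at hzR
    rcases hzR with ⟨p, hp, rfl⟩ | ⟨p, hp, rfl⟩
    · rw [SquareModel.mem_arc_zero] at hp
      rw [Homeomorph.symm_apply_apply, hp.1] at him
      linarith [him.1]
    · rw [SquareModel.mem_arc_two] at hp
      rw [Homeomorph.symm_apply_apply, hp.1] at him
      linarith [him.2]
  · -- `closure R ∖ P` read in the model: near the bottom or the top side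
    rintro z ⟨hzR, hzP⟩
    rw [hclR, mem_image_homeomorph_iff, mem_reProdIm] at hzR
    obtain ⟨hre, him1, him2⟩ := hzR
    have hzK : z ∉ Kmid := by
      intro hzK
      have hzD : z ∈ D.carrier := hKmidD hzK
      obtain ⟨q, hq, hqd⟩ := hfrc.exists_infDist_eq_dist hfrne z
      have hlt : min ε₁' (d₀ / 2) < infDist z (frontier D.carrier) := by
        rw [hqd]
        have := hfar z hzK q hq
        exact lt_of_le_of_lt (min_le_right _ _) (by linarith)
      exact hzP (mem_carrier_of_lt_infDist D.toJordanDomain P.toJordanDomain hclose hzD hlt)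
    rw [hKmid, mem_image_homeomorph_iff, mem_reProdIm] at hzK
    have him : ¬ ((Ψ.symm z).im ∈ Icc (-1 + 2 * t) (1 - 2 * t)) := fun h => hzK ⟨hre, h⟩
    rw [mem_Icc, not_and_or, not_le, not_le] at him
    rcases him with him | him
    · refine ⟨⟨(Ψ.symm z).re, -1⟩, Or.inl ?_, ?_⟩
      · rw [SquareModel.mem_arc_zero]; exact ⟨rfl, hre⟩
      · have h1 := dist_mk_le (Ψ.symm z) (Ψ.symm z).re (-1)
        have h2 : |(Ψ.symm z).im - (-1)| ≤ 3 * t := by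
          rw [abs_le]; constructor <;> linarith
        rw [sub_self, abs_zero, zero_add] at h1
        exact h1.trans h2
    · refine ⟨⟨(Ψ.symm z).re, 1⟩, Or.inr ?_, ?_⟩
      · rw [SquareModel.mem_arc_two]; exact ⟨rfl, hre⟩
      · have h1 := dist_mk_le (Ψ.symm z) (Ψ.symm z).re 1
        have h2 : |(Ψ.symm z).im - 1| ≤ 3 * t := by
          rw [abs_le]; constructor <;> linarith
        rw [sub_self, abs_zero, zero_add] at h1
        exact h1.trans h2
  · -- `P.arc 0` read in the model: near the bottom side
    intro z hz
    obtain ⟨q', hq', hd⟩ := harc 0 z hz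
    rw [mem_rectQuad_arc_zero] at hq'
    refine ⟨⟨max (-1) (min 1 q'.re), -1⟩, ?_, ?_⟩
    · rw [SquareModel.mem_arc_zero]; exact ⟨rfl, clamp_mem_Icc _⟩
    · have h1 := dist_mk_le q' (max (-1) (min 1 q'.re)) (-1)
      have h2 := abs_sub_clamp_le ht.le hq'.2
      have h3 : |q'.im - (-1)| ≤ t := by rw [hq'.1, abs_le]; constructor <;> linarith
      have := dist_triangle (Ψ.symm z) q' ⟨max (-1) (min 1 q'.re), -1⟩
      linarith
  · -- `P.arc 2` read in the model: near the top side
    intro z hz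
    obtain ⟨q', hq', hd⟩ := harc 2 z hz
    rw [mem_rectQuad_arc_two] at hq'
    refine ⟨⟨max (-1) (min 1 q'.re), 1⟩, ?_, ?_⟩
    · rw [SquareModel.mem_arc_two]; exact ⟨rfl, clamp_mem_Icc _⟩
    · have h1 := dist_mk_le q' (max (-1) (min 1 q'.re)) 1
      have h2 := abs_sub_clamp_le ht.le hq'.2
      have h3 : |q'.im - 1| ≤ t := by rw [hq'.1, abs_le]; constructor <;> linarith
      have := dist_triangle (Ψ.symm z) q' ⟨max (-1) (min 1 q'.re), 1⟩
      linarith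

/-- The boundary loop of `D_t` read in the model: the closed polygon through the corners of
`[-1-t, 1+t] × [-1+t, 1-t]`. [folklore] -/
theorem symm_perturbQuad_boundary (Ψ : ℂ ≃ₜ ℂ) {t : ℝ} (hx : (-1 - t : ℝ) < 1 + t)
    (hy : (-1 + t : ℝ) < 1 - t) (s : ℝ) :
    Ψ.symm ((perturbQuad Ψ (-1 - t) (1 + t) (-1 + t) (1 - t) hx hy).boundary s) =
      polygonLoop (rectVerts (1 + t) (1 - t)) s := by
  rw [perturbQuad_boundary, Homeomorph.symm_apply_apply,
    show ((1 + t - (-1 - t)) / 2 : ℝ) = 1 + t by ring,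
    show ((1 - t - (-1 + t)) / 2 : ℝ) = 1 - t by ring,
    show (⟨(-1 - t + (1 + t)) / 2, (-1 + t + (1 - t)) / 2⟩ : ℂ) = 0 from
      Complex.ext (by show ((-1 - t + (1 + t)) / 2 : ℝ) = 0; ring)
        (by show ((-1 + t + (1 - t)) / 2 : ℝ) = 0; ring),
    add_zero]

/-- The boundary loop of `D_t` lies in the closed rectangle, read in the model. [folklore] -/
theorem symm_perturbQuad_boundary_mem (Ψ : ℂ ≃ₜ ℂ) {x₀ x₁ y₀ y₁ : ℝ} (hx : x₀ < x₁)
    (hy : y₀ < y₁) (s : ℝ) :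
    Ψ.symm ((perturbQuad Ψ x₀ x₁ y₀ y₁ hx hy).boundary s) ∈ Icc x₀ x₁ ×ℂ Icc y₀ y₁ := by
  have := frontier_perturbQuad_subset Ψ hx hy
    ((perturbQuad Ψ x₀ x₁ y₀ y₁ hx hy).boundary_mem_frontier s)
  rwa [mem_image_homeomorph_iff] at this

/-- **`∂D_t → ∂(Ψ(square))` uniformly as `t → 0⁺`.** For every `ε > 0` there is `t₀ > 0` such
that for `0 < t ≤ t₀` the boundary loop of `D_t = Ψ((-1-t, 1+t) × (-1+t, 1-t))` is uniformly
`ε`-close (strictly) to that of `unitSquareQuad.map Ψ`. [folklore] -/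
theorem exists_forall_dist_perturbQuad_boundary_lt (Ψ : ℂ ≃ₜ ℂ) {ε : ℝ} (hε : 0 < ε) :
    ∃ t₀ > 0, ∀ (t : ℝ) (hx : (-1 - t : ℝ) < 1 + t) (hy : (-1 + t : ℝ) < 1 - t), 0 < t → t ≤ t₀ →
      ∀ s, dist ((perturbQuad Ψ (-1 - t) (1 + t) (-1 + t) (1 - t) hx hy).boundary s)
        ((unitSquareQuad.map Ψ).boundary s) < ε := by
  set K₂ : Set ℂ := Icc (-2) 2 ×ℂ Icc (-2) 2 with hK₂
  have hK₂c : IsCompact K₂ := isCompact_Icc.reProdIm isCompact_Icc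
  have huc := hK₂c.uniformContinuousOn_of_continuous Ψ.continuous.continuousOn
  rw [Metric.uniformContinuousOn_iff] at huc
  obtain ⟨η, hη, hΨ⟩ := huc ε hε
  refine ⟨η / 3, by positivity, fun t hx hy ht htη s => ?_⟩
  have ht1 : t < 1 := by linarith
  set D := perturbQuad Ψ (-1 - t) (1 + t) (-1 + t) (1 - t) hx hy with hD
  -- both boundary points read in the model
  have hmemD : Ψ.symm (D.boundary s) ∈ K₂ := by
    have := symm_perturbQuad_boundary_mem Ψ hx hy s
    rw [mem_reProdIm] at this
    obtain ⟨⟨h1, h2⟩, h3, h4⟩ := this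
    exact mem_reProdIm.2 ⟨⟨by linarith, by linarith⟩, by linarith, by linarith⟩
  have hmemU : Ψ.symm ((unitSquareQuad.map Ψ).boundary s) ∈ K₂ := by
    rw [DesignLowerContinuum.map_unitSquareQuad_eq]
    have := symm_perturbQuad_boundary_mem Ψ (by norm_num : (-1 : ℝ) < 1)
      (by norm_num : (-1 : ℝ) < 1) s
    rw [mem_reProdIm] at this
    obtain ⟨⟨h1, h2⟩, h3, h4⟩ := this
    exact mem_reProdIm.2 ⟨⟨by linarith, by linarith⟩, by linarith, by linarith⟩
  have hU : Ψ.symm ((unitSquareQuad.map Ψ).boundary s) = polygonLoop (rectVerts (1 : ℝ) 1) s := by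
    have e : unitSquareQuad.map Ψ =
        perturbQuad Ψ (-1 - 0) (1 + 0) (-1 + 0) (1 - 0) (by norm_num) (by norm_num) := by
      rw [DesignLowerContinuum.map_unitSquareQuad_eq]; congr 1 <;> norm_num
    rw [e, symm_perturbQuad_boundary]
    norm_num
  have hdist : dist (Ψ.symm (D.boundary s)) (Ψ.symm ((unitSquareQuad.map Ψ).boundary s)) < η := by
    rw [hD, symm_perturbQuad_boundary, hU]
    refine lt_of_le_of_lt (PolygonLoopDistLe.dist_polygonLoop_le (C := 2 * t) (by positivity)
      (by simp) (fun i hi => ?_) s) (by linarith)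
    refine (DesignLowerContinuum.dist_rectVerts_getElem_le (1 + t) (1 - t) 1 1
      (by simpa using hi)).trans (le_of_eq ?_)
    rw [show (1 : ℝ) + t - 1 = t by ring, show (1 : ℝ) - t - 1 = -t by ring, abs_neg,
      abs_of_pos ht]
    ring
  have := hΨ _ hmemD _ hmemU hdist
  rwa [Homeomorph.apply_symm_apply, Homeomorph.apply_symm_apply] at this

/-- **The arcs `0` and `2` of a conformal rectangle are separated**: for `s` a fifth of their
(positive) distance, no point is `2s`-close to both. [folklore] -/
theorem exists_arcs_separated (R : ConformalRectangle) :
    ∃ s > 0, ∀ z : ℂ, infDist z (R.arc 0) ≤ 2 * s → infDist z (R.arc 2) ≤ 2 * s → False := by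
  obtain ⟨d, hd, hfar⟩ := R.exists_pos_forall_lt_dist_arc
  refine ⟨d / 5, by positivity, fun z hz0 hz2 => ?_⟩
  obtain ⟨p, hp, hpd⟩ := (R.isCompact_arc 0).exists_infDist_eq_dist ⟨_, R.pt_mem_arc_self 0⟩ z
  obtain ⟨q, hq, hqd⟩ := (R.isCompact_arc 2).exists_infDist_eq_dist ⟨_, R.pt_mem_arc_self 2⟩ z
  have h1 := hfar p hp q hq
  have h2 := dist_triangle p z q
  rw [dist_comm p z, ← hpd, ← hqd] at h2
  linarith

end DesignUpperContinuum

end Summit.CriticalPhenomena.CardyFormulaZ2.Theorems.CardyQContinuation
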